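import Literature.NumberTheory.Rogawski1990.UnitFundamentalLemmaInertFlickerScalarsCM          -- ★ `exists_conjLocal_mul_eq_toLocalRing_of_valued_eq_one` (units are norms, 2-free), `exists_mul_conjLocal_eq_toLocalRing_iff`
import Literature.NumberTheory.Automorphic.WildSeamDockings                                     -- ★ p851682 (K1) `exists_v_eq_one_add_galAdicCompletionMap_eq_one` (`b + σ_w b = 1`, `|b|_w = 1`)
import Literature.NumberTheory.Automorphic.Liu2021.LemD1AsPrintedIndexedNonVacuityInertCofinite   -- ★ `valued_toPlace_uniformizer_of_isUnramifiedIn` (`ι_w ϖ_v` is a uniformiser)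
import Literature.NumberTheory.Automorphic.Liu2021.LemD1AsPrintedIndexedNonVacuityNonsplitPlace   -- ★ `not_isSquare_delta_sq_of_nonsplit`
import Literature.NumberTheory.Automorphic.UnitaryGroupNonsplitPlace                            -- ★ `LocalRing.eq_iff_apply_eq`, `PlacesOver.eq_of_smul_eq`
import HarnessLib

/-!
# The 2-FREE scalars of the trace frame at an inert unramified CM place: `b + σb = 1`, the uniformiser `π = ι_v(ϖ_v)` (a non-norm), and a
# unit `ε` of norm `−1` — every residue characteristic (Flicker 1998 §2 Prop. 3; Jacobowitz 1962 §7; O'Meara 1963 63:16; Serre 1979 V §2)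

Topic `NumberTheory/Rogawski1990`; namespace `Literature.NumberTheory.Rogawski1990`.  **Theorems only** (no `def`, no instance, no notation, no
named fact, no `sorry`); count-neutral; kernel lane `--supports stmt-HodgeConjecture-24833`.  Brick (P3b) «M1 ROW #1 — THE 2-FREE SCALAR PRODUCER»
of LH4-plan (g6) WORD #72 (price list T13-42 (4)), retiring row #1 of CENSUS-M1 `bf2b9cff` (LH4-p01 (g6)): the producer ★
`UnitFundamentalLemmaInertFlickerScalarsCM.exists_flicker_scalars_of_nonsplit (h2 : |2|_v = 1)` supplied `e = ½`, a non-norm `π`, `x x̄ = 2`,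
`y ȳ = −2`; the trace-frame literal layer (★ p851724 `FlickerTorusTraceFrame`, ★ p851760 `FlickerTorusTraceFrameClasses`, ★ `FlickerClassesTraceFrame`)
reads instead `b + σb = 1`, `σπ = π` with `π ∉ N(E_v^×)`, and `σε·ε = −1` — binders `hb hσπ hπN hε` — which exist with NO hypothesis on `|2|_v`.

On the carrier `E_v = L ⊗ L⁺_v = LocalRing L v` (`σ = conjLocal`), at a finite place `v` of `L⁺` NON-SPLIT (`c • w = w`) and UNRAMIFIED in `L`:
* (`conjLocal_apply_of_smul_eq_cm`, private: `(σ x)_w = σ_w (x_w)` at a non-split place.)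
* `exists_add_conjLocal_eq_one_of_nonsplit` — (K1) `∃ b`, `b + σb = 1`, `|b_w|_w = 1` (★ p851682 `WildSeamDockings.exists_v_eq_one_add_galAdicCompletionMap_eq_one`
  read on the `w`-factor of `E_v`: `(σ x)_w = σ_w (x_w)`, ★ `LocalRing.eq_iff_apply_eq`);
* `conjLocal_mul_self_ne_toLocalRing_uniformizer` — `π := ι_v(ϖ_v)` is NOT of the form `σz·z` (O'Meara 63:16 at an unramified inert place: norms have EVEN order,
  ★ `hilbertSymbol_eq_neg_one_of_odd_of_isUnramifiedIn` + the local norm dictionary ★ `exists_mul_conjLocal_eq_toLocalRing_iff`);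
* `exists_conjLocal_mul_self_eq_neg_one` — `∃ ε`, `σε·ε = −1` (the unit `−1` is a norm: ★ `exists_conjLocal_mul_eq_toLocalRing_of_valued_eq_one`, 2-free);
* **`exists_traceFrame_scalars_of_nonsplit`** — the package `∃ b π ε` (`hb`, `|b_w| = 1`, `hσπ`, `IsUnit π`, `hπN`, `π = ι_v(ϖ_v)`, `|π_w| = exp(−1)`, `hε`) and its
  `π π′`-form `exists_traceFrame_scalars_of_nonsplit'` (`π π′ = 1`).

CENSUS of ★ `…FlickerScalarsCM` :40–:99 (line → fate): :46 `exists_conjLocal_mul_eq_toLocalRing_of_valued_eq_one` KEPT (2-free; the `ε`-supplier here at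
`t = −1`); :71 `exists_flicker_scalars_of_nonsplit` SUPERSEDED (`e, x, y` dropped; `π` kept but PINNED to `ι_v(ϖ_v)`; new suppliers: `b` ★ p851682, `ε` :46).

## References
* [Flicker1998UnitaryFL] Y. Z. Flicker, *Elementary proof of the fundamental lemma for a unitary group*, Canad. J. Math. 50 (1998), §2 Prop. 3 pp. 78–79.
* [Jacobowitz1962] R. Jacobowitz, *Hermitian forms over local fields*, Amer. J. Math. 84 (1962), §7 Thm. 7.1 (trace condition at unramified dyadic places).
* [Omeara1963] O. T. O'Meara, *Introduction to Quadratic Forms* (1963), §63C Example 63:16 (norms at an unramified place = elements of even order).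
* [Serre1979] J.-P. Serre, *Local Fields* (1979), Ch. V §2 Prop. 3 (the trace is surjective in an unramified extension).
-/

set_option autoImplicit false

noncomputable section

open NumberField IsDedekindDomain
open scoped MatrixGroups

namespace Literature.NumberTheory.Rogawski1990

open Literature.NumberTheory.Automorphic Literature.NumberTheory.Automorphic.UnitaryGroup
open Literature.NumberTheory.QuadraticForms Literature.NumberTheory.NumberFields Literature.NumberTheory.GaloisRepresentations

variable (L : Type) [Field L] [NumberField L] [IsCMField L] (v : HeightOneSpectrum (𝓞 ↥(maximalRealSubfield L)))
  (w : PlacesOver L v) (hw : IsCMField.complexConj L • w.1 = w.1)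

/-! ## §1 The `w`-factor of `E_v` at a non-split place -/

include hw in
/-- `(σ x)_w = σ_w (x_w)`: `conjLocal` at the unique place above a non-split `v` is the Galois transport on that factor (★ `conjLocal_apply`, one place
above `v`; a `private` copy of ★ `Weil1982.UnitaryFinTopForm.conjLocal_apply_rankOne` ∕ ★ `conjLocal_apply_of_smul_eq'`, kept local to spare the import).
[cite: Omeara1963, §63C Example 63:16] -/
private theorem conjLocal_apply_of_smul_eq_cm (x : LocalRing L v) :
    conjLocal L (IsCMField.complexConj L) v x w = galAdicCompletionMap (L := L) (IsCMField.complexConj L) hw (x w) := by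
  have key : ∀ (w₁ : PlacesOver L v) (h₁ : IsCMField.complexConj L • w₁.1 = w.1),
      galAdicCompletionMap (L := L) (IsCMField.complexConj L) h₁ (x w₁) = galAdicCompletionMap (L := L) (IsCMField.complexConj L) hw (x w) := by
    intro w₁ h₁
    have e : w₁ = w := PlacesOver.eq_of_smul_eq (IsCMField.complexConj L) (IsCMField.complexConj_ne_one L) w hw w₁
    subst e
    rfl
  rw [conjLocal_apply]
  exact key ⟨(IsCMField.complexConj L)⁻¹ • w.1, under_inv_smul_eq (IsCMField.complexConj L) w⟩ (smul_inv_smul (IsCMField.complexConj L) w.1)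

/-! ## §2 (K1) The trace seed `b + σb = 1` -/

include hw in
/-- **(K1) THE TRACE SEED ON `E_v`**: at a finite place `v` of `L⁺` non-split and unramified in `L` there is `b ∈ E_v = L ⊗ L⁺_v` with `b + σb = 1` whose
`w`-component is a UNIT (`|b_w|_w = 1`, so `b_w, σ_w b_w ∈ 𝒪_w`) — ★ p851682 (the trace `𝒪_w → 𝒪_v` hits `1` in an unramified extension) read on the one factor
`E_w` of `E_v`.  Replaces `e = ½` (`2e = 1`) at dyadic `v`. [cite: Serre1979, Ch. V §2 Prop. 3] [cite: Jacobowitz1962, §7 Thm. 7.1] -/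
theorem exists_add_conjLocal_eq_one_of_nonsplit (hunr : Algebra.IsUnramifiedIn (𝓞 L) v.asIdeal) :
    ∃ b : LocalRing L v, b + conjLocal L (IsCMField.complexConj L) v b = 1 ∧ Valued.v (b w) = 1 := by
  haveI : Algebra.IsQuadraticExtension ↥(maximalRealSubfield L) L := IsCMField.isQuadraticExtension L
  obtain ⟨b₀, hvb₀, hb₀⟩ := WildSeamDockings.exists_v_eq_one_add_galAdicCompletionMap_eq_one (IsCMField.complexConj L) w
    (IsCMField.complexConj_ne_one L) hw hunr
  -- the element of `E_v = Π_{w' ∣ v} L_{w'}` with `w`-component `b₀` (one factor)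
  haveI : Subsingleton (PlacesOver L v) := PlacesOver.subsingleton_of_smul_eq (IsCMField.complexConj L) (IsCMField.complexConj_ne_one L) w hw
  letI : Unique (PlacesOver L v) := uniqueOfSubsingleton w
  let π : LocalRing L v ≃+* w.1.adicCompletion L := RingEquiv.piUnique fun w' : PlacesOver L v => w'.1.adicCompletion L
  obtain ⟨b, hbw⟩ : ∃ b : LocalRing L v, b w = b₀ := ⟨π.symm b₀, π.apply_symm_apply b₀⟩
  refine ⟨b, ?_, by rw [hbw]; exact hvb₀⟩
  rw [LocalRing.eq_iff_apply_eq (IsCMField.complexConj L) (IsCMField.complexConj_ne_one L) w hw, Pi.add_apply,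
    conjLocal_apply_of_smul_eq_cm L v w hw, hbw, Pi.one_apply]
  exact hb₀

/-! ## §3 The uniformiser `π = ι_v(ϖ_v)` is not a norm -/

omit [IsCMField L] in
/-- `ι_v(ϖ_v)` is a unit of `E_v = ∏_{w′} L_{w′}` (non-zero in every factor). [cite: NeukirchANT1999, Ch. II §6] -/
private theorem isUnit_toLocalRing_uniformizer' :
    IsUnit (toLocalRing L v (HeckeCharacter.uniformizer ↥(maximalRealSubfield L) v : v.adicCompletion ↥(maximalRealSubfield L))) := by
  refine isUnit_iff_exists_inv.2 ⟨fun w' => (toPlace v w' (HeckeCharacter.uniformizer ↥(maximalRealSubfield L) v : v.adicCompletion ↥(maximalRealSubfield L)))⁻¹,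
    funext fun w' => ?_⟩
  rw [Pi.mul_apply, toLocalRing_apply, Pi.one_apply, mul_inv_cancel₀]
  exact (map_ne_zero (toPlace v w')).2 (Units.ne_zero _)

include hw in
/-- **THE UNIFORMISER IS NOT A NORM**: at a finite place `v` of `L⁺` non-split and unramified in `L`, `π := ι_v(ϖ_v)` is not of the form `σz·z`, `z ∈ E_v` —
O'Meara 63:16 «in an unramified quadratic extension the norms are the elements of even order» (`(ϖ_v, θ)_v = −1` for `θ ∉ L⁺_v²`, `ord_v ϖ_v = 1` odd), read
through the local norm dictionary ★ `exists_mul_conjLocal_eq_toLocalRing_iff`.  Flicker's «`Δ ∈ F − NE`», now a uniformiser. [cite: Omeara1963, §63C Example 63:16]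
[cite: Flicker1998UnitaryFL, §2 Prop. 3 p. 79] -/
theorem conjLocal_mul_self_ne_toLocalRing_uniformizer (hunr : Algebra.IsUnramifiedIn (𝓞 L) v.asIdeal) (z : LocalRing L v) :
    conjLocal L (IsCMField.complexConj L) v z * z ≠
      toLocalRing L v (HeckeCharacter.uniformizer ↥(maximalRealSubfield L) v : v.adicCompletion ↥(maximalRealSubfield L)) := by
  intro hz
  haveI : Algebra.IsQuadraticExtension ↥(maximalRealSubfield L) L := IsCMField.isQuadraticExtension L
  haveI : CharZero (v.adicCompletion ↥(maximalRealSubfield L)) :=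
    charZero_of_injective_algebraMap (algebraMap (↥(maximalRealSubfield L)) _).injective
  haveI : NeZero (2 : v.adicCompletion ↥(maximalRealSubfield L)) := ⟨two_ne_zero⟩
  obtain ⟨α, hα0, hcα, hsq⟩ := cmQuadraticGenerator_spec L
  have hθ : α * α = algebraMap ↥(maximalRealSubfield L) L (cmQuadraticGenerator L : ↥(maximalRealSubfield L)) := by rw [← sq]; exact hsq
  have hθ0 : algebraMap (↥(maximalRealSubfield L)) (v.adicCompletion ↥(maximalRealSubfield L))
      (cmQuadraticGenerator L : ↥(maximalRealSubfield L)) ≠ 0 := by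
    rw [map_ne_zero]
    intro h
    rw [h, map_zero, sq_eq_zero_iff] at hsq
    exact hα0 hsq
  set ϖ : (v.adicCompletion ↥(maximalRealSubfield L))ˣ := HeckeCharacter.uniformizer ↥(maximalRealSubfield L) v with hϖdef
  -- `ϖ_v ∈ N` by the dictionary …
  have hmem := (exists_mul_conjLocal_eq_toLocalRing_iff (L := L) v ϖ).1 ⟨z, by rw [mul_comm]; exact hz⟩
  have h1 : hilbertSymbol (v.adicCompletion ↥(maximalRealSubfield L)) (ϖ : v.adicCompletion ↥(maximalRealSubfield L))
      (algebraMap (↥(maximalRealSubfield L)) (v.adicCompletion ↥(maximalRealSubfield L)) (cmQuadraticGenerator L : ↥(maximalRealSubfield L))) = 1 :=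
    (hilbertSymbol_eq_one_iff_mem_quadraticNormSubgroup hθ0 ϖ).2 hmem
  -- … but `(ϖ_v, θ)_v = −1` (odd order, `θ ∉ L⁺_v²` at a non-split place)
  have hodd : Odd (WithZero.log (Valued.v (ϖ : v.adicCompletion ↥(maximalRealSubfield L)))) := by
    rw [hϖdef, HeckeCharacter.valued_uniformizer, WithZero.log_exp]
    exact ⟨-1, by norm_num⟩
  have h2 := hilbertSymbol_eq_neg_one_of_odd_of_isUnramifiedIn ↥(maximalRealSubfield L) v hsq (algebraMap_ne_of_complexConj_eq_neg hcα hα0) hunr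
    (Liu2021.LemD1IndexedNonVacuityNonsplitPlace.not_isSquare_delta_sq_of_nonsplit L v (IsCMField.complexConj L) hcα hα0 w hw hθ) ϖ.ne_zero hodd
  rw [h1] at h2
  norm_num at h2

/-! ## §4 A unit of norm `−1` -/

/-- **A UNIT OF NORM `−1`**: at a finite place `v` of `L⁺` unramified in `L` there is `ε ∈ E_v` with `σε·ε = −1` — `−1` is a unit of `L⁺_v`, and units are norms
in an unramified quadratic extension at EVERY residue characteristic (★ `exists_conjLocal_mul_eq_toLocalRing_of_valued_eq_one`, O'Meara 63:16).  In Flicker's frame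
this `ε` hid inside `y ȳ = −2 = (−1)·2`. [cite: Omeara1963, §63C Example 63:16] [cite: Jacobowitz1962, §7 Thm. 7.1] -/
theorem exists_conjLocal_mul_self_eq_neg_one (hunr : Algebra.IsUnramifiedIn (𝓞 L) v.asIdeal) :
    ∃ ε : LocalRing L v, conjLocal L (IsCMField.complexConj L) v ε * ε = -1 := by
  have hm1 : Valued.v (-1 : v.adicCompletion ↥(maximalRealSubfield L)) = 1 := by rw [Valuation.map_neg, Valuation.map_one]
  obtain ⟨ε, hε⟩ := exists_conjLocal_mul_eq_toLocalRing_of_valued_eq_one L v hunr hm1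
  exact ⟨ε, by rw [hε, map_neg, map_one]⟩

/-! ## §5 The package -/

include hw in
/-- **THE 2-FREE SCALARS OF THE TRACE FRAME AT AN INERT UNRAMIFIED CM PLACE** (replaces ★ `exists_flicker_scalars_of_nonsplit (h2 : |2|_v = 1)`): at a finite place
`v` of `L⁺` non-split and unramified in `L`, on `E_v = L ⊗ L⁺_v` with `σ = conjLocal`, there are `b π ε` with: `b + σb = 1` and `|b_w|_w = 1` (trace seed, (K1));
`σπ = π`, `π` a unit, `σz·z ≠ π` for all `z` (a non-norm), `π = ι_v(ϖ_v)` with `|π_w|_w = exp(−1)` (a uniformiser of `E_w`, `e(w|v) = 1`); `σε·ε = −1` — the binders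
`hb hσπ hπN hε` of the trace-frame literal layer (★ `FlickerTorusTraceFrameClasses`, ★ `FlickerClassesTraceFrame.conjClassesIn_traceTorusElt_eq`), at EVERY residue
characteristic. [cite: Flicker1998UnitaryFL, §2 Prop. 3 pp. 78–79] [cite: Jacobowitz1962, §7 Thm. 7.1] [cite: Omeara1963, §63C Example 63:16] [cite: Serre1979, Ch. V §2 Prop. 3] -/
theorem exists_traceFrame_scalars_of_nonsplit (hunr : Algebra.IsUnramifiedIn (𝓞 L) v.asIdeal) :
    ∃ b π ε : LocalRing L v,
      b + conjLocal L (IsCMField.complexConj L) v b = 1 ∧ Valued.v (b w) = 1 ∧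
      conjLocal L (IsCMField.complexConj L) v π = π ∧ IsUnit π ∧ (∀ z : LocalRing L v, conjLocal L (IsCMField.complexConj L) v z * z ≠ π) ∧
      π = toLocalRing L v (HeckeCharacter.uniformizer ↥(maximalRealSubfield L) v : v.adicCompletion ↥(maximalRealSubfield L)) ∧
      Valued.v (π w) = WithZero.exp (-1 : ℤ) ∧
      conjLocal L (IsCMField.complexConj L) v ε * ε = -1 := by
  obtain ⟨b, hb, hvb⟩ := exists_add_conjLocal_eq_one_of_nonsplit L v w hw hunr
  obtain ⟨ε, hε⟩ := exists_conjLocal_mul_self_eq_neg_one L v hunr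
  refine ⟨b, toLocalRing L v (HeckeCharacter.uniformizer ↥(maximalRealSubfield L) v : v.adicCompletion ↥(maximalRealSubfield L)), ε, hb, hvb,
    conjLocal_toLocalRing (IsCMField.complexConj L) v _, isUnit_toLocalRing_uniformizer' L v,
    conjLocal_mul_self_ne_toLocalRing_uniformizer L v w hw hunr, rfl, ?_, hε⟩
  rw [toLocalRing_apply]
  exact Liu2021.LemD1IndexedNonVacuityInertCofinite.valued_toPlace_uniformizer_of_isUnramifiedIn L v hunr w

include hw in
/-- **The `π π′ = 1` form** of the package (binder `hππ′` of the literal layer): `∃ b π π′ ε` with `b + σb = 1`, `|b_w|_w = 1`, `σπ = π`, `π π′ = 1`, `σz·z ≠ π`,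
`|π_w|_w = exp(−1)`, `σε·ε = −1`. [cite: Flicker1998UnitaryFL, §2 Prop. 3 pp. 78–79] [cite: Omeara1963, §63C Example 63:16] -/
theorem exists_traceFrame_scalars_of_nonsplit' (hunr : Algebra.IsUnramifiedIn (𝓞 L) v.asIdeal) :
    ∃ b π π' ε : LocalRing L v,
      b + conjLocal L (IsCMField.complexConj L) v b = 1 ∧ Valued.v (b w) = 1 ∧
      conjLocal L (IsCMField.complexConj L) v π = π ∧ π * π' = 1 ∧ (∀ z : LocalRing L v, conjLocal L (IsCMField.complexConj L) v z * z ≠ π) ∧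
      Valued.v (π w) = WithZero.exp (-1 : ℤ) ∧
      conjLocal L (IsCMField.complexConj L) v ε * ε = -1 := by
  obtain ⟨b, π, ε, hb, hvb, hσπ, hπu, hπN, -, hvπ, hε⟩ := exists_traceFrame_scalars_of_nonsplit L v w hw hunr
  obtain ⟨π', hππ'⟩ := hπu.exists_right_inv
  exact ⟨b, π, π', ε, hb, hvb, hσπ, hππ', hπN, hvπ, hε⟩

end Literature.NumberTheory.Rogawski1990
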